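import Summits.CriticalPhenomena.PercolationContinuityZ3.Theorems.PercNearOneGluingNoHeavyLowerTailSunflowerRestrictionSingleton
import HarnessLib

/-!
# `NoHeavyLowerTail` (crux stmt-CriticalPhenomena-4575), abstract sunflower cubic: CONCAVITY OF THE COORDINATE PENCIL and restriction
# monotonicity (MZ) at every coordinate without two disjoint same-direction petal transitions

Support file (seat `prim-l12-p2` gen 8; `--supports stmt-CriticalPhenomena-4575`; companion of `…SunflowerRestrictionSingleton` (p222183),
`…SunflowerRestrictionTwoPetal` (p225252), `…SunflowerPartitionReduction` (p217435)).  Memo: run/shared/lean/prim/prim-l12/prim-l12-p2/FINDING-g8-MZ-PETAL-FREE.md §3.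
Nothing is asserted about the crux; no `sorry`.

SETTING.  `F : Sunflower α`, `e ∉ W`, sections `φX = lab X`, `ψX = lab (insert e X)` on `2^W`, and the four LIFT SUMS
`b₀ = Σ s6H(φ,φ,φ) = F.ZP W ∅ ∅ ∅`, `b₁ = Σ s6H(ψ,φ,φ)` (`F.ZP (insert e W) ∅ ∅ ∅ = 3 b₁`, `Sunflower.nested_insert_eq`), `b₂ = Σ s6H(ψ,ψ,φ)`,
`b₃ = Σ s6H(ψ,ψ,ψ) = F.ZP W {e} {e} {e}` (the upper section), all sums over ordered 3-partitions of `W` (`nested`).  These are the Bernstein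
coefficients of the cubic `Z` along the pencil from the lower to the upper section (prove-1 g25 §11.1 "T₀..T₃"; (MZ) is `3b₁ ≥ b₀`).

MAIN RESULTS (this work).
* `exch_le_of_not_sameDir` (`decide`): the two-argument EXCHANGE inequality `s(x⁰,y⁰,z) + s(x¹,y¹,z) ≤ s(x¹,y⁰,z) + s(x⁰,y¹,z)` holds for comparable
  `x⁰ ≤ x¹`, `y⁰ ≤ y¹` in `M₃` unless BOTH transitions are same-direction petal transitions (both exits `petal → ⊤` or both entries `0 → petal`)
  — the nonnegative part of the exchange-defect table of seat prim-ineq-prove-1 (FINDING-MUIR g26 §7).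
* `Sunflower.two_b1_ge`, `Sunflower.two_b2_ge`: if NO ordered 3-partition `(X,S,T)` of `W` has two blocks making same-direction petal transitions,
  then `2b₁ ≥ b₀ + b₂` and `2b₂ ≥ b₁ + b₃` — the pencil `(b₀,b₁,b₂,b₃)` is CONCAVE (block symmetries `nested_swap12/23` + the exchange inequality termwise).
* `Sunflower.ZP_insert_ge_of_no_sameDir`: hence `2·F.ZP W ∅ ∅ ∅ + F.ZP W {e} {e} {e} ≤ F.ZP (insert e W) ∅ ∅ ∅` (`3b₁ ≥ 2b₀ + b₃`), unconditionally;
  and (MZ) at `e`, `F.ZP W ∅ ∅ ∅ ≤ F.ZP (insert e W) ∅ ∅ ∅`, as soon as `0 ≤ F.ZP W ∅ ∅ ∅ + F.ZP W {e} {e} {e}` — in particular whenever the partition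
  lemma holds for the two sections (`Sunflower.ZP_le_ZP_insert_of_no_sameDir`).  Special case: coordinates acting by PURE BOTTOM-TO-TOP PROMOTION
  (`lab (insert e X) ∈ {lab X, ⊤}` with `lab X = 0` whenever it changes; `Sunflower.ZP_insert_ge_of_pure_promotion`).
Census (memo §3): the hypothesis holds for 56 % of all (sunflower, coordinate) pairs on `2^5` and adds cases not covered by p222183/p225252/p226120;
with those it covers 99.4 % of the pairs at `|α| = 5` and ≈ 96 % of random pairs at `|α| = 6` — the residue (lifted rainbows AND two disjoint same-direction
transitions AND `lab {e} = 0`) is the open core of `RestrictionMonotonicity`.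
-/

namespace Summit.CriticalPhenomena.PercolationContinuityZ3.Theorems.SunflowerPartition

open Finset

/-! ## The exchange inequality away from same-direction petal transitions -/

/-- **Exchange inequality** (this work; the nonnegative entries of prove-1's exchange-defect table): for comparable `x⁰ ≤ x¹`, `y⁰ ≤ y¹` in `M₃`
that are NOT both exits (`petal → ⊤`) and NOT both entries (`0 → petal`), `s(x⁰,y⁰,z) + s(x¹,y¹,z) ≤ s(x¹,y⁰,z) + s(x⁰,y¹,z)` for every `z`. -/
theorem exch_le_of_not_sameDir : ∀ x0 x1 y0 y1 z : Fin 5, (x0 = x1 ∨ x0 = 0 ∨ x1 = 4) → (y0 = y1 ∨ y0 = 0 ∨ y1 = 4) →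
    ¬ (((x0 ≠ 0 ∧ x0 ≠ 4) ∧ x1 = 4 ∧ (y0 ≠ 0 ∧ y0 ≠ 4) ∧ y1 = 4) ∨ (x0 = 0 ∧ (x1 ≠ 0 ∧ x1 ≠ 4) ∧ y0 = 0 ∧ (y1 ≠ 0 ∧ y1 ≠ 4))) →
    s6H x0 y0 z + s6H x1 y1 z ≤ s6H x1 y0 z + s6H x0 y1 z := by
  decide

variable {α : Type*} [DecidableEq α]

namespace Sunflower

variable (F : Sunflower α)

/-- **First concavity inequality `2b₁ ≥ b₀ + b₂`** (this work): if no ordered 3-partition `(X,S,T)` of `W` has its first two blocks making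
same-direction petal transitions under `e`, then `nested s6H(φ,φ,φ) + nested s6H(ψ,ψ,φ) ≤ 2·nested s6H(ψ,φ,φ)`. -/
theorem two_b1_ge (W : Finset α) (e : α)
    (hnd : ∀ X ∈ W.powerset, ∀ S ∈ (W \ X).powerset,
      ¬ (((F.lab X ≠ 0 ∧ F.lab X ≠ 4) ∧ F.lab (insert e X) = 4 ∧ (F.lab S ≠ 0 ∧ F.lab S ≠ 4) ∧ F.lab (insert e S) = 4) ∨
         (F.lab X = 0 ∧ (F.lab (insert e X) ≠ 0 ∧ F.lab (insert e X) ≠ 4) ∧ F.lab S = 0 ∧ (F.lab (insert e S) ≠ 0 ∧ F.lab (insert e S) ≠ 4)))) :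
    nested W (fun X S T => s6H (F.lab X) (F.lab S) (F.lab T))
        + nested W (fun X S T => s6H (F.lab (insert e X)) (F.lab (insert e S)) (F.lab T))
      ≤ 2 * nested W (fun X S T => s6H (F.lab (insert e X)) (F.lab S) (F.lab T)) := by
  have hsym : nested W (fun X S T => s6H (F.lab (insert e X)) (F.lab S) (F.lab T))
      = nested W (fun X S T => s6H (F.lab X) (F.lab (insert e S)) (F.lab T)) := by
    rw [nested_swap12 W (fun X S T => s6H (F.lab X) (F.lab (insert e S)) (F.lab T))]
    unfold nested
    refine sum_congr rfl fun X _ => sum_congr rfl fun S _ => ?_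
    exact (s6H_symm _ _ _).1
  rw [two_mul]
  nth_rewrite 2 [hsym]
  unfold nested
  rw [← sum_add_distrib, ← sum_add_distrib]
  refine sum_le_sum fun X hX => ?_
  rw [← sum_add_distrib, ← sum_add_distrib]
  refine sum_le_sum fun S hS => ?_
  exact exch_le_of_not_sameDir _ _ _ _ _ (F.lab_mono (subset_insert e X)) (F.lab_mono (subset_insert e S)) (hnd X hX S hS)

/-- **Second concavity inequality `2b₂ ≥ b₁ + b₃`** (this work), under the same hypothesis:
`nested s6H(ψ,φ,φ) + nested s6H(ψ,ψ,ψ) ≤ 2·nested s6H(ψ,ψ,φ)`. -/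
theorem two_b2_ge (W : Finset α) (e : α)
    (hnd : ∀ X ∈ W.powerset, ∀ S ∈ (W \ X).powerset,
      ¬ (((F.lab X ≠ 0 ∧ F.lab X ≠ 4) ∧ F.lab (insert e X) = 4 ∧ (F.lab S ≠ 0 ∧ F.lab S ≠ 4) ∧ F.lab (insert e S) = 4) ∨
         (F.lab X = 0 ∧ (F.lab (insert e X) ≠ 0 ∧ F.lab (insert e X) ≠ 4) ∧ F.lab S = 0 ∧ (F.lab (insert e S) ≠ 0 ∧ F.lab (insert e S) ≠ 4)))) :
    nested W (fun X S T => s6H (F.lab (insert e X)) (F.lab S) (F.lab T))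
        + nested W (fun X S T => s6H (F.lab (insert e X)) (F.lab (insert e S)) (F.lab (insert e T)))
      ≤ 2 * nested W (fun X S T => s6H (F.lab (insert e X)) (F.lab (insert e S)) (F.lab T)) := by
  have hsym : nested W (fun X S T => s6H (F.lab (insert e X)) (F.lab (insert e S)) (F.lab T))
      = nested W (fun X S T => s6H (F.lab (insert e X)) (F.lab S) (F.lab (insert e T))) := by
    rw [nested_swap23 W (fun X S T => s6H (F.lab (insert e X)) (F.lab S) (F.lab (insert e T)))]
    unfold nested
    refine sum_congr rfl fun X _ => sum_congr rfl fun S _ => ?_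
    exact (s6H_symm _ _ _).2
  rw [two_mul]
  nth_rewrite 2 [hsym]
  unfold nested
  rw [← sum_add_distrib, ← sum_add_distrib]
  refine sum_le_sum fun X hX => ?_
  rw [← sum_add_distrib, ← sum_add_distrib]
  refine sum_le_sum fun S hS => ?_
  -- exchange on the blocks `(S, T)` with spectator `lab (insert e X)`; the hypothesis is used at the partition `(S, T, X)`
  have hXW : X ⊆ W := mem_powerset.1 hX
  have hSW : S ⊆ W \ X := mem_powerset.1 hS
  have hS' : S ∈ W.powerset := mem_powerset.2 (hSW.trans sdiff_subset)
  have hT' : (W \ X) \ S ∈ (W \ S).powerset := mem_powerset.2 (sdiff_subset_sdiff sdiff_subset subset_rfl)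
  have key := exch_le_of_not_sameDir _ _ _ _ (F.lab (insert e X)) (F.lab_mono (subset_insert e S))
    (F.lab_mono (subset_insert e ((W \ X) \ S))) (hnd S hS' ((W \ X) \ S) hT')
  -- move the spectator to the first argument by the symmetries of `s6H`
  have c1 := s6H_cycle (F.lab S) (F.lab ((W \ X) \ S)) (F.lab (insert e X))
  have c2 := s6H_cycle (F.lab (insert e S)) (F.lab (insert e ((W \ X) \ S))) (F.lab (insert e X))
  have c3 := s6H_cycle (F.lab (insert e S)) (F.lab ((W \ X) \ S)) (F.lab (insert e X))
  have c4 := s6H_cycle (F.lab S) (F.lab (insert e ((W \ X) \ S))) (F.lab (insert e X))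
  linarith

/-- **Concave pencil ⟹ `3b₁ ≥ 2b₀ + b₃`** (this work): under the no-same-direction hypothesis,
`2·F.ZP W ∅ ∅ ∅ + F.ZP W {e} {e} {e} ≤ F.ZP (insert e W) ∅ ∅ ∅` (`e ∉ W`; unconditional). -/
theorem ZP_insert_ge_of_no_sameDir (W : Finset α) (e : α) (he : e ∉ W)
    (hnd : ∀ X ∈ W.powerset, ∀ S ∈ (W \ X).powerset,
      ¬ (((F.lab X ≠ 0 ∧ F.lab X ≠ 4) ∧ F.lab (insert e X) = 4 ∧ (F.lab S ≠ 0 ∧ F.lab S ≠ 4) ∧ F.lab (insert e S) = 4) ∨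
         (F.lab X = 0 ∧ (F.lab (insert e X) ≠ 0 ∧ F.lab (insert e X) ≠ 4) ∧ F.lab S = 0 ∧ (F.lab (insert e S) ≠ 0 ∧ F.lab (insert e S) ≠ 4)))) :
    2 * F.ZP W ∅ ∅ ∅ + F.ZP W {e} {e} {e} ≤ F.ZP (insert e W) ∅ ∅ ∅ := by
  have h3 : F.ZP W {e} {e} {e} = nested W (fun X S T => s6H (F.lab (insert e X)) (F.lab (insert e S)) (F.lab (insert e T))) := by
    rw [nested_eq_sum_filter]
    unfold Sunflower.ZP partsOf
    refine sum_congr rfl fun q _ => ?_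
    rw [← insert_eq, ← insert_eq, ← insert_eq]
  rw [F.ZP_empty_eq_nested, F.ZP_empty_eq_nested, h3, F.nested_insert_eq W e he]
  have c1 := F.two_b1_ge W e hnd
  have c2 := F.two_b2_ge W e hnd
  linarith

/-- **(MZ) at a coordinate without two disjoint same-direction petal transitions** (this work): under the hypothesis of
`ZP_insert_ge_of_no_sameDir`, and given `0 ≤ F.ZP W ∅ ∅ ∅ + F.ZP W {e} {e} {e}` (e.g. the partition lemma for the two sections),
`F.ZP W ∅ ∅ ∅ ≤ F.ZP (insert e W) ∅ ∅ ∅`. -/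
theorem ZP_le_ZP_insert_of_no_sameDir (W : Finset α) (e : α) (he : e ∉ W)
    (hnd : ∀ X ∈ W.powerset, ∀ S ∈ (W \ X).powerset,
      ¬ (((F.lab X ≠ 0 ∧ F.lab X ≠ 4) ∧ F.lab (insert e X) = 4 ∧ (F.lab S ≠ 0 ∧ F.lab S ≠ 4) ∧ F.lab (insert e S) = 4) ∨
         (F.lab X = 0 ∧ (F.lab (insert e X) ≠ 0 ∧ F.lab (insert e X) ≠ 4) ∧ F.lab S = 0 ∧ (F.lab (insert e S) ≠ 0 ∧ F.lab (insert e S) ≠ 4))))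
    (hpos : 0 ≤ F.ZP W ∅ ∅ ∅ + F.ZP W {e} {e} {e}) :
    F.ZP W ∅ ∅ ∅ ≤ F.ZP (insert e W) ∅ ∅ ∅ := by
  have h := F.ZP_insert_ge_of_no_sameDir W e he hnd
  linarith

/-- **Pure bottom-to-top coordinates** (this work): if adding `e` changes labels only by promoting bottom sets to the kernel
(`lab (insert e X) = lab X`, or `lab X = 0` and `lab (insert e X) = ⊤`, for all `X ⊆ W`), the pencil is concave:
`2·F.ZP W ∅ ∅ ∅ + F.ZP W {e} {e} {e} ≤ F.ZP (insert e W) ∅ ∅ ∅`. -/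
theorem ZP_insert_ge_of_pure_promotion (W : Finset α) (e : α) (he : e ∉ W)
    (hD : ∀ X, X ⊆ W → (F.lab (insert e X) = F.lab X ∨ (F.lab X = 0 ∧ F.lab (insert e X) = 4))) :
    2 * F.ZP W ∅ ∅ ∅ + F.ZP W {e} {e} {e} ≤ F.ZP (insert e W) ∅ ∅ ∅ := by
  refine F.ZP_insert_ge_of_no_sameDir W e he fun X hX S _ => ?_
  have hXW : X ⊆ W := mem_powerset.1 hX
  rcases hD X hXW with h | ⟨h0, h4⟩
  · rintro (⟨⟨_, hx4⟩, hx1, _⟩ | ⟨hx0, ⟨hx1, _⟩, _⟩)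
    · exact hx4 (h ▸ hx1)
    · exact hx1 (h.trans hx0)
  · rintro (⟨⟨hx0, _⟩, _, _⟩ | ⟨_, ⟨_, hx1⟩, _⟩)
    · exact hx0 h0
    · exact hx1 h4

end Sunflower

end Summit.CriticalPhenomena.PercolationContinuityZ3.Theorems.SunflowerPartition
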